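import Summits.SmoothPoincare4.SmoothPoincare4.Theses.SchoenfliesSplit
import Literature.Topology.FourManifolds.ShellCapExtension
import Literature.Topology.FourManifolds.SchoenfliesBallForm
import HarnessLib.Audit

/-!
# Birth skeleton (BC3) — crux `SchsplitShellCap` (stmt-SmoothPoincare4-11868), route `SchoenfliesSplit`

`Cruxes/SchsplitShellCap/Lines/birth.lean` · registrar planner-skel-stmt-SmoothPoincare4-11868-0 ·
2026-08-17 · mode skeleton-register (route re-audit bin REPAIRABLE).  The crux is FIXED and is
concluded BY NAME:

  `Summit.SmoothPoincare4.SmoothPoincare4.Theses.SchoenfliesSplit.SchsplitShellCap`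

= (B♯) the COLLARED / SHELL-CAPPING form of the smooth 4-dimensional Schoenflies problem, in the
pure `ℝ⁴`-calculus vocabulary of `Literature/Topology/FourManifolds/ShellCapExtension.lean`: a
`C^∞` embedding `f` of a two-sided spherical shell `A_ε = {1 - ε < ‖x‖ < 1 + ε} ⊆ ℝ⁴` into `ℝ⁴`
(open image, `C^∞` left inverse `finv`), given two-sidedness data `ℝ⁴ ∖ f(S³) = P ⊔ Q` (open,
`P` bounded, inner half-shell into `P`, outer half-shell into `Q`), agrees on a thinner shell
`A_δ` with a `C^∞` embedding `F` of the ball `B(0, 1 + δ)` (open image, `C^∞` inverse): the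
collared 3-sphere `f(S³)` bounds a smooth ball COMPATIBLY WITH ITS COLLAR.

## The cut — research half / theorem half, glued by STRAIGHTENING THE COLLAR

The crux docstring records the folklore equivalence "modulo theorems (uniqueness of collars,
smooth Jordan–Brouwer) B♯ ⇔ [Schoenflies, ball form in ℝ⁴] ∧ [Cerf Γ₄ = 0]" and the route's
NOT-DECOMPOSED-YET paragraph names exactly this glued split.  The skeleton types it with three
named statements and a PROVED composition:

* `stub_schoenflies` — BY NAME the summit's conjecture leaf
  `Summit.SmoothPoincare4.SmoothPoincare4.SmoothSchoenfliesConjectureFour` (smooth 4D Schoenflies,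
  equator form: every smooth `S³ ⊆ S⁴` is carried onto the equator by a diffeomorphism of `S⁴`;
  Kirby list 4.32; token-identical with the route's support item `SchsplitSchoenflies`
  (stmt-SmoothPoincare4-0372) and with the crux `SbdSchoenflies` of route SmoothBijectionDefect
  (stmt-SmoothPoincare4-13498), whose own crux chain therefore serves this stub too).  OPEN since
  Mazur 1959 — the research content of the crux, and its hardest stub.
* `stub_ballTransport` — KNOWN mathematics (formal size L): the conjecture leaf implies the
  COLLARED BALL FORM IN `ℝ⁴` (`CollaredBallForm`, §0): for a shell embedding `f` with two-sidedness
  data `(P, Q)`, the inside region `P` is parametrised by a smooth open embedding `h` of a ball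
  `B(0, 1 + η) ⊋ 𝔻⁴` with `h(𝔹⁴) = P` and `h(S³) = f(S³)`.  Proof in print: pull `f(S³)` back to
  `S⁴` by stereographic projection `σ` (a smooth `S³ ⊆ S⁴`, since `f|S³` is a smooth embedding);
  by the leaf and `SmoothSchoenfliesConjectureFour.exists_ball_not_mem` (SchoenfliesBallForm.lean,
  PROVED: balls on both sides) the closed side NOT containing the pole `∞` is `e(𝔻⁴)` for a smooth
  embedding `e : ℝ⁴ → S⁴` with `e(∂𝔻⁴) = σ⁻¹ f(S³)`; `σ⁻¹(P)` and `σ⁻¹(Q) ∪ {∞}` are open, disjoint,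
  non-empty and cover `S⁴ ∖ σ⁻¹ f(S³)`, whose components are the two open sides (smooth
  Jordan–Brouwer, tree `JordanBrouwerClosedHypersurface.lean` / `SchoenfliesSeparation.lean`), so
  `σ⁻¹(P) = e(𝔹⁴)` (the side missing `∞`, as `P` is bounded); `h := σ ∘ e` on a ball `B(0,1+η)`
  with `e(B(0,1+η)) ∌ ∞` (compactness).  No Cerf, no collar uniqueness is used here.
* `stub_cerf` — BY NAME the named fact `Literature.Topology.FourManifolds.cerf_pi0Diff_sphere_three`
  (Cerf 1968, Théorème 1: every diffeomorphism of `S³` is diffeotopic to the identity or to a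
  reflection; `Γ₄ = 0`).  A THEOREM (Cerf 1968; Hatcher 1983), tier-0 formalisation debt of size
  XL; the tree reduces it and the twisted-sphere form `SchsplitCerf` (stmt-SmoothPoincare4-8758,
  staffed crux chain `Cruxes/SchsplitCerf/Lines/*`) to the single apex `π₀ Diff(D³ rel ∂) = 0`.

`SchsplitShellCap_of : Sig.stub_schoenflies → Sig.stub_ballTransport → Sig.stub_cerf →
SchsplitShellCap` is PROVED (§3, ≈ 130 lines, axioms standard): given the shell embedding `f` and
`(P, Q)`, the collared ball form yields `h`; on a thin shell `A_δ₂` with `f(A_δ₂) ⊆ h(B(0,1+η))`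
(compactness of `S³`, `exists_twoSidedShell_subset`) the STRAIGHTENED shell map `g := h⁻¹ ∘ f` is a
shell embedding which PRESERVES THE UNIT SPHERE, sends the inner half-shell into `𝔹⁴` (because
`f(inner) ⊆ P = h(𝔹⁴)`) and the outer half-shell outside `𝔻⁴` (because `f(outer) ⊆ Q` is disjoint
from `P = h(𝔹⁴)` and from `f(S³) = h(S³)`); the tree's PROVED sphere-preserving filling theorem
`exists_ballFill_of_shellEmbedding` (Cerf in ambient form + uniqueness of collars of `∂𝔻⁴`,
`CollarUniquenessBall.lean`), fed with `stub_cerf`, caps `g` by `G` on `B(0, 1 + δ)`; and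
`F := h ∘ G`, `Finv := G⁻¹ ∘ h⁻¹` cap `f`: `F = h ∘ g = f` on `A_δ`, `F` smooth with open image and
smooth inverse.  Each arrow hands over a different object (diffeomorphism of `S⁴` ↦ collared ball
parametrisation `h` ↦ sphere-preserving shell embedding `g` ↦ cap), none is a conjunction seam, and
the two halves are exactly the RESEARCH content (Schoenflies) and the THEOREM content (Cerf) the
crux's "why it might fail" line names.

Hardest stub: `stub_schoenflies` (open since 1959 in any form; known slices: Schoenflies balls
with a 3-handle-free decomposition / middle level of genus ≤ 2, Scharlemann 1984; Gompf's killing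
of the Cappell–Shaneson candidates, 1991).  A refutation of it is an exotic Schoenflies ball, i.e.
an invertible exotic 4-sphere: it refutes this crux, conjunct (B) of the route and
`SmoothPoincare4` itself — informative either way.  `stub_ballTransport` and `stub_cerf` are
theorems (their failure could only be a typing failure; §0 records why `CollaredBallForm` is the
right interface: it is precisely what the composition consumes, and it follows from the crux too,
by taking `h := F`).

BC3 probes (registrar, 2026-08-17, folder `bc/probe_all.lean`): for each of the three stub
signatures `T` (and, for information, for `CollaredBallForm`), `example : T → SchsplitShellCap` and
`example : T → SmoothPoincare4` by `first | exact? | simpa | aesop` FAIL (no stub is cheaply the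
crux or the summit); raw results in the registrar's NOTES.md and in the crux evidence note.

Disproof used: none exists for this crux (`ledger crux ls stmt-SmoothPoincare4-11868`: no
workfiles before this one, no `Disproof.lean`, no `Theorems/SchsplitShellCap/Negative/*`,
2026-08-17); negatives index of the summit: 0 refuted statements (2026-08-17).  The refuter's
route-review notes (2026-08-15/16: statement elaborates, read-back = collared Schoenflies ⇔
Schoenflies ∧ Γ₄ = 0 mod theorems) and the grounder's note (g39-22: open; sphere-preserving case
proved in tree as `exists_ballFill_of_shellEmbedding`) are honoured verbatim: the sphere-preserving
case is the theorem the composition invokes, and the two named conjuncts are the two by-name stubs.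

Sources: Mazur1959; Scharlemann1984 (doi:10.1016/0040-9383(84)90040-5); Gompf1991Killing;
KirbyProblems1997 (Problem 4.32); Kirby1989 (Ch. I §6, PDF p. 14: ball form = equator form);
CerfDiffeoSphere1968 (Ch. I §1, Théorème 1, Lemme 2, Corollaire 1); Hatcher1983;
MilnorHCobordism1965 (§9); HirschDT1976 (Ch. 8, Thms. 1.8, 2.1, 3.1); Palais1960 (Thm. B);
arXiv:1912.09029 (Budney–Gabai, §9, Thm. 9.11).
-/

noncomputable section

-- every `Summit.SmoothPoincare4.SmoothPoincare4.…` name repeats the summit = sub-problem segment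
-- (D-0017 layout); the duplicate is deliberate.
set_option linter.dupNamespace false
set_option linter.unusedVariables false

namespace Summit.SmoothPoincare4.SmoothPoincare4.Cruxes.SchsplitShellCap.Birth

open scoped Manifold ContDiff Topology
open Set Function Metric Literature.Topology.FourManifolds
open Summit.SmoothPoincare4.SmoothPoincare4.Theses.SchoenfliesSplit (SchsplitShellCap)

/-- Local notation: the model space `ℝ⁴`. -/
local notation "𝔼⁴" => EuclideanSpace ℝ (Fin 4)

/-! ## §0 Vocabulary — the collared ball form of Schoenflies in `ℝ⁴` -/

/-- **Smooth 4D Schoenflies, COLLARED BALL FORM in `ℝ⁴`** (the interface the composition consumes).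
For every shell embedding — `f` of class `C^∞` on the two-sided shell
`A_ε = {1 - ε < ‖x‖ < 1 + ε}` with open image and a `C^∞` left inverse `finv` on `f(A_ε)` (the
first five clauses of the crux, verbatim) — and every two-sidedness datum `(P, Q)` — open,
disjoint, `P ∪ Q = ℝ⁴ ∖ f(S³)`, `P` bounded, inner half-shell into `P`, outer half-shell into `Q`
(the crux's sixth clause, un-∃-ed) — the inside region is a COLLAR-PARAMETRISED smooth ball:
there are `h, hinv : ℝ⁴ → ℝ⁴` and `η > 0` with `h` of class `C^∞` on `B(0, 1 + η)`, open image,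
`hinv` a `C^∞` left inverse on that image, `h(𝔹⁴) = P` and `h(S³) = f(S³)`.
By smooth Jordan–Brouwer `P` is THE bounded component of `ℝ⁴ ∖ f(S³)` (it is non-empty: it contains
the image of the inner half-shell), so this says: the closed inside region `P ∪ f(S³)` of a
collared 3-sphere in `ℝ⁴` is a smoothly embedded closed 4-ball — the printed ball form of the
Schoenflies problem (Kirby 1989, Ch. I §6; Kirby list 4.32), for collared spheres, read in `ℝ⁴`.
It follows from the conjecture leaf (`Sig.stub_ballTransport`) and, conversely, from the crux
modulo smooth Jordan–Brouwer (take `h := F`, `η := δ`: `F(𝔹⁴) ⊆ P ∪ Q` is connected and meets `P`,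
so lies in `P`, and it is clopen in `P`, which is connected — so `F(𝔹⁴) = P`).
[Kirby1989 Ch. I §6; KirbyProblems1997 4.32; Mazur1959] -/
def CollaredBallForm : Prop :=
  ∀ (f finv : 𝔼⁴ → 𝔼⁴) (ε : ℝ), 0 < ε →
    ContDiffOn ℝ ∞ f {x | 1 - ε < ‖x‖ ∧ ‖x‖ < 1 + ε} →
    IsOpen (f '' {x | 1 - ε < ‖x‖ ∧ ‖x‖ < 1 + ε}) →
    ContDiffOn ℝ ∞ finv (f '' {x | 1 - ε < ‖x‖ ∧ ‖x‖ < 1 + ε}) →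
    (∀ x : 𝔼⁴, 1 - ε < ‖x‖ → ‖x‖ < 1 + ε → finv (f x) = x) →
    ∀ P Q : Set 𝔼⁴, IsOpen P → IsOpen Q → Disjoint P Q → P ∪ Q = (f '' sphere 0 1)ᶜ →
      Bornology.IsBounded P →
      (∀ x : 𝔼⁴, 1 - ε < ‖x‖ → ‖x‖ < 1 → f x ∈ P) →
      (∀ x : 𝔼⁴, 1 < ‖x‖ → ‖x‖ < 1 + ε → f x ∈ Q) →
      ∃ (h hinv : 𝔼⁴ → 𝔼⁴) (η : ℝ), 0 < η ∧
        ContDiffOn ℝ ∞ h (ball 0 (1 + η)) ∧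
        IsOpen (h '' ball 0 (1 + η)) ∧
        ContDiffOn ℝ ∞ hinv (h '' ball 0 (1 + η)) ∧
        (∀ x ∈ ball (0 : 𝔼⁴) (1 + η), hinv (h x) = x) ∧
        h '' ball 0 1 = P ∧
        h '' sphere 0 1 = f '' sphere 0 1

/-! ## §1 The stub SIGNATURES (`Sig.stub_<name>`; the skeleton audit reads the hypotheses of
`SchsplitShellCap_of` BY NAME, heads = stub names) -/

/-- **STUB 1 — SMOOTH 4D SCHOENFLIES** (OPEN — the heart), BY NAME the summit's conjecture leaf
`Summit.SmoothPoincare4.SmoothPoincare4.SmoothSchoenfliesConjectureFour`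
(`Summits/SmoothPoincare4/SmoothPoincare4/Theorems/SmoothSchoenfliesConjectureFour.lean`; equator
form: every smooth embedding `S³ → S⁴` is carried onto `sphereFourEquator` by a diffeomorphism of
`S⁴`).  Token-identical with the route's support item `SchsplitSchoenflies` (stmt-0372, spelled
through the Literature copy `Literature.Topology.FourManifolds.SmoothSchoenfliesConjectureFour`,
`Iff.rfl` below) and with the crux `SbdSchoenflies` of route SmoothBijectionDefect (stmt-13498).
Why it might fail: an exotic Schoenflies ball (= an invertible exotic 4-sphere) refutes it; known
only for 3-handle-free / genus ≤ 2 Schoenflies balls (Scharlemann 1984) and for the killed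
Cappell–Shaneson candidates (Gompf 1991).  Sources: Mazur1959, KirbyProblems1997 4.32, Kirby1989
Ch. I §6, Scharlemann1984, Gompf1991Killing, arXiv:1912.09029 §9.  Size: open problem. -/
abbrev Sig.stub_schoenflies : Prop :=
  _root_.Summit.SmoothPoincare4.SmoothPoincare4.SmoothSchoenfliesConjectureFour

/-- **STUB 2 — TRANSPORT TO THE COLLARED BALL FORM IN `ℝ⁴`** (KNOWN mathematics; formal size L).
The conjecture leaf implies `CollaredBallForm`.  Proof: `Σ := σ⁻¹(f(S³)) ⊆ S⁴` (`σ` = stereographic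
projection from a pole `∞`; `σ⁻¹ ∘ f|S³` is a smooth embedding `S³ → S⁴` because `f` is a
diffeomorphism of the open shell onto an open set); by the leaf, in the PROVED both-sides ball form
`SmoothSchoenfliesConjectureFour.exists_ball_not_mem` (SchoenfliesBallForm.lean) with `p := ∞`,
there is a smooth embedding `e : ℝ⁴ → S⁴` with `e(∂𝔻⁴) = Σ` and `∞ ∉ e(𝔻⁴)`; the two components of
`S⁴ ∖ Σ` (smooth Jordan–Brouwer: `JordanBrouwerClosedHypersurface.lean`,
`SchoenfliesSeparation.lean`) are `e(𝔹⁴)` and the other open side, while `σ⁻¹(P)` and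
`σ⁻¹(Q) ∪ {∞}` are disjoint non-empty open sets covering `S⁴ ∖ Σ` — hence each is one component,
and `σ⁻¹(P) = e(𝔹⁴)` (the component missing `∞`); finally `h := σ ∘ e` restricted to a ball
`B(0, 1 + η)` with `e(B(0, 1 + η)) ∌ ∞` (compactness of `𝔻⁴`), `hinv := e⁻¹ ∘ σ⁻¹`.  Cerf-free and
collar-free.  Why it might fail: only as typed (component bookkeeping of `(P, Q)`; smoothness of
`σ ∘ e` read in the single chart `ℝ⁴`).  Sources: Kirby1989 Ch. I §6 (ball form = equator form),
Palais1960 Thm. B, HirschDT1976 Ch. 8 Thm. 3.1, Mazur1959. -/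
def Sig.stub_ballTransport : Prop :=
  Sig.stub_schoenflies → CollaredBallForm

/-- **STUB 3 — CERF'S THEOREM `π₀ Diff(S³)` / `Γ₄ = 0`**, BY NAME the named fact
`Literature.Topology.FourManifolds.cerf_pi0Diff_sphere_three` (RadialExtension.lean): every
diffeomorphism of `S³` is diffeotopic to the identity or to a hyperplane reflection.  A THEOREM
(Cerf 1968, Théorème 1; reproved through Hatcher's Smale conjecture 1983): no mathematical failure
mode; it fails only as a FORMAL task (XL, no formal proof exists).  It is the hypothesis `hC` of the
tree's proved `exists_ballFill_of_shellEmbedding`, and it is implied back by the crux (apply B♯ to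
the radial extension of `φ ∈ Diff S³`: the cap restricted to `𝔻⁴` extends `φ`).  Shared formal
debt with `SchsplitCerf` (stmt-8758; both reduce in the tree to `π₀ Diff(D³ rel ∂) = 0`).
Sources: CerfDiffeoSphere1968 (Ch. I §1, Thm. 1, Lemme 2, Cor. 1), Hatcher1983,
MilnorHCobordism1965 §9, KervaireMilnorAnnals1963. -/
abbrev Sig.stub_cerf : Prop :=
  cerf_pi0Diff_sphere_three

/-! ### Consistency with the route vocabulary (definitional, `Iff.rfl`) -/

/-- Stub 1 is, up to the name of the copy, the route's support item `SchsplitSchoenflies`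
(stmt-SmoothPoincare4-0372 := the Literature copy of the conjecture leaf). -/
example : Sig.stub_schoenflies ↔
    Summit.SmoothPoincare4.SmoothPoincare4.Theses.SchoenfliesSplit.SchsplitSchoenflies :=
  Iff.rfl

/-- The antecedent of `CollaredBallForm` is verbatim the antecedent of the crux (shell embedding +
two-sidedness data, the latter un-∃-ed): the crux is `CollaredBallForm` with the conclusion
"`P` is a collar-parametrised ball" replaced by "`f` is capped compatibly with its collar". -/
example : SchsplitShellCap ↔
    ∀ (f finv : 𝔼⁴ → 𝔼⁴) (ε : ℝ), 0 < ε →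
      ContDiffOn ℝ ∞ f {x | 1 - ε < ‖x‖ ∧ ‖x‖ < 1 + ε} →
      IsOpen (f '' {x | 1 - ε < ‖x‖ ∧ ‖x‖ < 1 + ε}) →
      ContDiffOn ℝ ∞ finv (f '' {x | 1 - ε < ‖x‖ ∧ ‖x‖ < 1 + ε}) →
      (∀ x : 𝔼⁴, 1 - ε < ‖x‖ → ‖x‖ < 1 + ε → finv (f x) = x) →
      (∃ P Q : Set 𝔼⁴, IsOpen P ∧ IsOpen Q ∧ Disjoint P Q ∧ P ∪ Q = (f '' sphere 0 1)ᶜ ∧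
        Bornology.IsBounded P ∧ (∀ x : 𝔼⁴, 1 - ε < ‖x‖ → ‖x‖ < 1 → f x ∈ P) ∧
        ∀ x : 𝔼⁴, 1 < ‖x‖ → ‖x‖ < 1 + ε → f x ∈ Q) →
      ∃ (F Finv : 𝔼⁴ → 𝔼⁴) (δ : ℝ), 0 < δ ∧ δ ≤ ε ∧ ContDiffOn ℝ ∞ F (ball 0 (1 + δ)) ∧
        (∀ x : 𝔼⁴, 1 - δ < ‖x‖ → ‖x‖ < 1 + δ → F x = f x) ∧ IsOpen (F '' ball 0 (1 + δ)) ∧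
        ContDiffOn ℝ ∞ Finv (F '' ball 0 (1 + δ)) ∧
        ∀ x ∈ ball (0 : 𝔼⁴) (1 + δ), Finv (F x) = x :=
  Iff.rfl

/-! ## §2 The registered stubs (the ONLY `sorry`s of this file) -/

/-- Registered stub 1 (OPEN, hardest, the crux's research content): the smooth 4-dimensional
Schoenflies conjecture, by name.  See `Sig.stub_schoenflies`. -/
theorem stub_schoenflies : Sig.stub_schoenflies := by
  sorry

/-- Registered stub 2 (known, L): the conjecture leaf gives the collared ball form in `ℝ⁴`.  See
`Sig.stub_ballTransport`. -/
theorem stub_ballTransport : Sig.stub_ballTransport := by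
  sorry

/-- Registered stub 3 (theorem of Cerf, XL formalisation debt): `π₀ Diff(S³) = 0` in Cerf's
orientation-free form, by name.  See `Sig.stub_cerf`. -/
theorem stub_cerf : Sig.stub_cerf := by
  sorry

/-! ## §3 The composition — the crux BY NAME from the three stubs (real proof, no `sorry`) -/

/-- **Skeleton theorem.**  Schoenflies (leaf) + transport to the collared ball form in `ℝ⁴` +
Cerf imply the crux `Theses.SchoenfliesSplit.SchsplitShellCap` BY NAME.  Fix the shell embedding
`f, finv, ε` and the two-sidedness data `(P, Q)`.  (1) The collared ball form parametrises the
inside: `h(𝔹⁴) = P`, `h(S³) = f(S³)`, `h` a smooth open embedding of `B = B(0, 1 + η)`.  (2) A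
thin two-sided shell `A_δ₂ ⊆ A_ε` has `f(A_δ₂) ⊆ h(B)` (the open set `A_ε ∩ f⁻¹ h(B)` contains
`S³`; `exists_twoSidedShell_subset`).  (3) The straightened shell map `g := hinv ∘ f` on `A_δ₂`
is a shell embedding (`C^∞`, open image, `C^∞` inverse `finv ∘ h`) with `g(S³) = S³`, inner
half-shell into `𝔹⁴` (`f(inner) ⊆ P = h(𝔹⁴)`), outer half-shell outside `𝔻⁴` (`f(outer) ⊆ Q`
misses `P = h(𝔹⁴)` and `f(S³) = h(S³)`).  (4) `exists_ballFill_of_shellEmbedding` (PROVED in the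
tree from Cerf in ambient form and uniqueness of collars), fed with `stub_cerf`, caps `g` by `G`
on `B(0, 1 + δ)`, `δ ≤ δ₂ ≤ ε`, with `G(B(0,1+δ)) = 𝔹⁴ ∪ g({1 ≤ ‖x‖ < 1 + δ}) ⊆ B`.  (5) `F := h ∘ G`,
`Finv := Ginv ∘ hinv` cap `f`. -/
theorem SchsplitShellCap_of :
    Sig.stub_schoenflies → Sig.stub_ballTransport → Sig.stub_cerf → SchsplitShellCap := by
  intro hSch hTr hC f finv ε hε hf hfo hfinv hleft hPQ
  obtain ⟨P, Q, hPo, hQo, hPQd, hPQu, hPb, hinP, houtQ⟩ := hPQ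
  -- (1) Schoenflies in collared ball form (leaf + transport): parametrise the inside region `P`
  have hBall : CollaredBallForm := hTr hSch
  obtain ⟨h, hinv, η, hη, hh, hho, hhinv, hhleft, hhball, hhsph⟩ :=
    hBall f finv ε hε hf hfo hfinv hleft P Q hPo hQo hPQd hPQu hPb hinP houtQ
  -- names for the shell and the parameter ball
  set S : Set 𝔼⁴ := {x | 1 - ε < ‖x‖ ∧ ‖x‖ < 1 + ε} with hSdef
  set B : Set 𝔼⁴ := ball (0 : 𝔼⁴) (1 + η) with hBdef
  have hSo : IsOpen S :=
    (isOpen_lt continuous_const continuous_norm).inter (isOpen_lt continuous_norm continuous_const)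
  have hleft' : ∀ x ∈ S, finv (f x) = x := fun x hx => hleft x hx.1 hx.2
  have hright : ∀ y ∈ h '' B, h (hinv y) = y := by
    rintro _ ⟨b, hb, rfl⟩
    rw [hhleft b hb]
  have hsphB : sphere (0 : 𝔼⁴) 1 ⊆ B := fun x hx => by
    rw [mem_sphere_zero_iff_norm] at hx
    show x ∈ ball (0 : 𝔼⁴) (1 + η)
    rw [mem_ball_zero_iff, hx]
    linarith
  have hball1B : ball (0 : 𝔼⁴) 1 ⊆ B := ball_subset_ball (by linarith)
  have hinvhB : hinv '' (h '' B) = B := by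
    rw [image_image]
    exact EqOn.image_eq_self fun b hb => hhleft b hb
  have hsphS : sphere (0 : 𝔼⁴) 1 ⊆ S := fun x hx => by
    rw [mem_sphere_zero_iff_norm] at hx
    exact ⟨by rw [hx]; linarith, by rw [hx]; linarith⟩
  -- (2) a thin two-sided shell whose `f`-image lies in the open neighbourhood `h '' B` of `f(S³)`
  set U : Set 𝔼⁴ := S ∩ f ⁻¹' (h '' B) with hUdef
  have hUo : IsOpen U := hf.continuousOn.isOpen_inter_preimage hSo hho
  have hsphU : sphere (0 : 𝔼⁴) 1 ⊆ U := fun x hx => by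
    refine ⟨hsphS hx, ?_⟩
    show f x ∈ h '' B
    have hfx : f x ∈ f '' sphere (0 : 𝔼⁴) 1 := mem_image_of_mem f hx
    rw [← hhsph] at hfx
    exact image_mono hsphB hfx
  obtain ⟨δ₁, hδ₁, -, hδ₁U⟩ := exists_twoSidedShell_subset hUo hsphU
  set δ₂ : ℝ := min δ₁ ε with hδ₂def
  have hδ₂ : 0 < δ₂ := lt_min hδ₁ hε
  have hδ₂ε : δ₂ ≤ ε := min_le_right _ _
  have hδ₂δ₁ : δ₂ ≤ δ₁ := min_le_left _ _
  set T : Set 𝔼⁴ := {x | 1 - δ₂ < ‖x‖ ∧ ‖x‖ < 1 + δ₂} with hTdef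
  have hTo : IsOpen T :=
    (isOpen_lt continuous_const continuous_norm).inter (isOpen_lt continuous_norm continuous_const)
  have hTU : ∀ x : 𝔼⁴, 1 - δ₂ < ‖x‖ → ‖x‖ < 1 + δ₂ → x ∈ U := fun x h1 h2 =>
    hδ₁U x (by linarith) (by linarith)
  have hTS : T ⊆ S := fun x hx => (hTU x hx.1 hx.2).1
  have hTB : ∀ x : 𝔼⁴, 1 - δ₂ < ‖x‖ → ‖x‖ < 1 + δ₂ → f x ∈ h '' B := fun x h1 h2 =>
    (hTU x h1 h2).2
  -- (3) the straightened shell map `g := hinv ∘ f`, with inverse `ginv := finv ∘ h`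
  set g : 𝔼⁴ → 𝔼⁴ := fun x => hinv (f x) with hgdef
  set ginv : 𝔼⁴ → 𝔼⁴ := fun y => finv (h y) with hginvdef
  have hg_eq : ∀ (x b : 𝔼⁴), b ∈ B → f x = h b → g x = b := fun x b hb hxb => by
    simp only [hgdef]
    rw [hxb, hhleft b hb]
  have hgB : ∀ x : 𝔼⁴, 1 - δ₂ < ‖x‖ → ‖x‖ < 1 + δ₂ → g x ∈ B := fun x h1 h2 => by
    obtain ⟨b, hb, hbx⟩ := hTB x h1 h2
    rw [hg_eq x b hb hbx.symm]
    exact hb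
  have hhg : ∀ x : 𝔼⁴, 1 - δ₂ < ‖x‖ → ‖x‖ < 1 + δ₂ → h (g x) = f x := fun x h1 h2 =>
    hright (f x) (hTB x h1 h2)
  have hgT : ContDiffOn ℝ ∞ g T :=
    hhinv.comp (hf.mono hTS) fun x hx => hTB x hx.1 hx.2
  have hfTo : IsOpen (f '' T) := isOpen_image_of_leftInvOn hfo hfinv.continuousOn hleft' hTo hTS
  have hgTo : IsOpen (g '' T) := by
    have himg : g '' T = hinv '' (f '' T) := (image_image hinv f T).symm
    rw [himg]
    refine isOpen_image_of_leftInvOn (f := hinv) (finv := h) (S := h '' B) (O := f '' T)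
      ?_ ?_ hright hfTo ?_
    · rw [hinvhB]
      exact isOpen_ball
    · rw [hinvhB]
      exact hh.continuousOn
    · rintro _ ⟨x, hx, rfl⟩
      exact hTB x hx.1 hx.2
  have hginvT : ContDiffOn ℝ ∞ ginv (g '' T) := by
    refine hfinv.comp (hh.mono ?_) ?_
    · rintro _ ⟨x, hx, rfl⟩
      exact hgB x hx.1 hx.2
    · rintro _ ⟨x, hx, rfl⟩
      show h (g x) ∈ f '' S
      rw [hhg x hx.1 hx.2]
      exact mem_image_of_mem f (hTS hx)
  have hgleft : ∀ x : 𝔼⁴, 1 - δ₂ < ‖x‖ → ‖x‖ < 1 + δ₂ → ginv (g x) = x := fun x h1 h2 => by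
    show finv (h (g x)) = x
    rw [hhg x h1 h2]
    exact hleft x (by linarith) (by linarith)
  have hgsph : g '' sphere 0 1 = sphere 0 1 := by
    have himg : g '' sphere (0 : 𝔼⁴) 1 = hinv '' (f '' sphere (0 : 𝔼⁴) 1) :=
      (image_image hinv f _).symm
    rw [himg, ← hhsph, image_image]
    exact EqOn.image_eq_self fun b hb => hhleft b (hsphB hb)
  have hgin : ∀ x : 𝔼⁴, 1 - δ₂ < ‖x‖ → ‖x‖ < 1 → ‖g x‖ < 1 := fun x h1 h2 => by
    have hxP : f x ∈ P := hinP x (by linarith) h2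
    rw [← hhball] at hxP
    obtain ⟨b, hb, hbx⟩ := hxP
    rw [hg_eq x b (hball1B hb) hbx.symm]
    exact mem_ball_zero_iff.1 hb
  have hgout : ∀ x : 𝔼⁴, 1 < ‖x‖ → ‖x‖ < 1 + δ₂ → 1 < ‖g x‖ := fun x h1 h2 => by
    have hxQ : f x ∈ Q := houtQ x h1 (by linarith)
    obtain ⟨b, hb, hbx⟩ := hTB x (by linarith) h2
    rw [hg_eq x b hb hbx.symm]
    by_contra hle
    rcases (not_lt.1 hle).lt_or_eq with hlt | heq
    · -- `‖b‖ < 1`: then `f x = h b ∈ h(𝔹⁴) = P`, contradicting `f x ∈ Q`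
      have hbP : h b ∈ P := by
        rw [← hhball]
        exact mem_image_of_mem h (mem_ball_zero_iff.2 hlt)
      have hbQ : h b ∈ Q := by
        rw [hbx]
        exact hxQ
      exact Set.disjoint_left.1 hPQd hbP hbQ
    · -- `‖b‖ = 1`: then `f x = h b ∈ h(S³) = f(S³)`, contradicting `f x ∈ Q ⊆ (f(S³))ᶜ`
      have hbS : h b ∈ f '' sphere (0 : 𝔼⁴) 1 := by
        rw [← hhsph]
        exact mem_image_of_mem h (mem_sphere_zero_iff_norm.2 heq)
      have hQc : f x ∈ (f '' sphere (0 : 𝔼⁴) 1)ᶜ := by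
        rw [← hPQu]
        exact Or.inr hxQ
      have hxS : f x ∈ f '' sphere (0 : 𝔼⁴) 1 := by
        rw [← hbx]
        exact hbS
      exact hQc hxS
  -- (4) Cerf + uniqueness of collars (PROVED tree theorem): cap the sphere-preserving shell map `g`
  obtain ⟨G, Ginv, δ, hδ, hδδ₂, hG, hGg, -, hGim, hGo, hGinv, hGleft⟩ :=
    exists_ballFill_of_shellEmbedding hC hδ₂ hgT hgTo hginvT hgleft hgsph hgin hgout
  have hδε : δ ≤ ε := hδδ₂.trans hδ₂ε
  have hGB : ∀ x ∈ ball (0 : 𝔼⁴) (1 + δ), G x ∈ B := fun x hx => by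
    have hGx : G x ∈ G '' ball (0 : 𝔼⁴) (1 + δ) := mem_image_of_mem G hx
    rw [hGim] at hGx
    rcases hGx with hGx | ⟨x', hx', hx'G⟩
    · exact hball1B hGx
    · rw [← hx'G]
      exact hgB x' (by linarith [hx'.1]) (by linarith [hx'.2])
  have hGsub : G '' ball (0 : 𝔼⁴) (1 + δ) ⊆ B := by
    rintro _ ⟨x, hx, rfl⟩
    exact hGB x hx
  -- (5) `F := h ∘ G`, `Finv := Ginv ∘ hinv` cap `f` compatibly with its collar
  refine ⟨fun x => h (G x), fun y => Ginv (hinv y), δ, hδ, hδε, ?_, ?_, ?_, ?_, ?_⟩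
  · -- smoothness of `F` on the ball
    exact hh.comp hG hGB
  · -- `F = f` on the thin two-sided shell
    intro x h1 h2
    show h (G x) = f x
    rw [hGg x h1 h2]
    exact hhg x (by linarith) (by linarith)
  · -- the image of the ball is open
    have himg : (fun x => h (G x)) '' ball (0 : 𝔼⁴) (1 + δ) = h '' (G '' ball (0 : 𝔼⁴) (1 + δ)) :=
      (image_image h G _).symm
    rw [himg]
    exact isOpen_image_of_leftInvOn hho hhinv.continuousOn hhleft hGo hGsub
  · -- smoothness of `Finv` on the image
    have hsub : (fun x => h (G x)) '' ball (0 : 𝔼⁴) (1 + δ) ⊆ h '' B := by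
      rintro _ ⟨x, hx, rfl⟩
      exact mem_image_of_mem h (hGB x hx)
    have hmaps : MapsTo hinv ((fun x => h (G x)) '' ball (0 : 𝔼⁴) (1 + δ))
        (G '' ball (0 : 𝔼⁴) (1 + δ)) := by
      rintro _ ⟨x, hx, rfl⟩
      show hinv (h (G x)) ∈ G '' ball (0 : 𝔼⁴) (1 + δ)
      rw [hhleft (G x) (hGB x hx)]
      exact mem_image_of_mem G hx
    exact hGinv.comp (hhinv.mono hsub) hmaps
  · -- `Finv ∘ F = id` on the ball
    intro x hx
    show Ginv (hinv (h (G x))) = x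
    rw [hhleft (G x) (hGB x hx)]
    exact hGleft x hx

/-- The crux by name, closed modulo the three registered stubs (its axiom closure contains
`sorryAx` through the stubs only; `SchsplitShellCap_of` itself is sorry-free). -/
theorem schsplitShellCap_of_stubs : SchsplitShellCap :=
  SchsplitShellCap_of stub_schoenflies stub_ballTransport stub_cerf

end Summit.SmoothPoincare4.SmoothPoincare4.Cruxes.SchsplitShellCap.Birth

end
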